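import Mathlib
import Summits.Ventures.HodgeRepro.Tier4.Target
import Summits.Ventures.HodgeRepro.Tier4.Line3.Defs
import Summits.Ventures.HodgeRepro.Tier4.Line3.LocaliserS
import Summits.Ventures.HodgeRepro.Tier4.Line3.KMDatum
import Summits.Ventures.HodgeRepro.Tier4.Line3.Majorant
import Summits.Ventures.HodgeRepro.Tier4.Line3.ClassBoundGauss
import Summits.Ventures.HodgeRepro.Tier4.Line3.ClassBoundDef

/-!
# Tier4/Line3/LatticeGaussDefs — the objects of rung (R2) THE LATTICE GAUSSIAN SUM (definitions, with their
characterising lemmas)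

Blind re-derivation cell `pub-hodge-repro`, Tier 4 «PROVE THE STEP» (README §9–§10), LINE L3, seat t4-x2 (reserve
wall-breaker) on (R2) of L3.5's residual (lead g385 S12860 (R-IV); L2-p1's census S12833; the registered statement
S12875, proved on the concatenation S12944).  The theorems live in `LatticeEmbedLemmas`, `LatticeGaussPointwise`,
`LatticeGaussSum` and `SuppMajorantBound`; this module carries ONLY the definitions they share, so that the review
of definitions happens once:

* `embV v = (σ (v i))_{σ, i}` — the archimedean embedding of `E′³` into `(E′ →+* ℂ) → Fin 3 → ℂ` (sup norm), as a
  function, as an additive map (`embAdd`), injective (`embV_injective`); `latt L` — the image of an `𝒪_{E′}`-submodule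
  `L ⊆ E′³` as a `ℤ`-submodule (`mem_latt`), with the bijection `lattEquiv L : L ≃ latt L`;
* `vecFactor c₁ e v z = (1 + ‖y‖)^e (Σ_i ‖y_i‖)² e^{−(π/2) maj(y, z)} · gaussDefAt c₁ v`, `y = ballCoord v` — the per-vector
  factor of t4-L2-p3's majorant `majorantDefAt` (ClassBoundDef);
* the constants `kCinv = Σ ‖C⁻¹_{ij}‖`, `kC = Σ ‖C_{ij}‖`, `cGauss c₁ = min c₁ (π / (24 kC²))` (the Gaussian exponent),
  `kPoly e = (max 1 kCinv)^{max e 0} (3 kCinv)²` (the polynomial prefactor);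
* `gaussMaj K₁ k a x = K₁ (1 + ‖x‖)^k e^{−a ‖x‖²}` — the Gaussian majorant on a normed space;
* `linesOf L = {lines x : ∀ j, x j ∈ L}` — the line tuples of `L⁴`, and `tupOf L w` — a chosen tuple of `L` representing
  `w ∈ linesOf L`.

Nothing here asserts anything about the truth of (P); HC_CM is NOT proved by anyone in this repository.
-/

set_option autoImplicit false

noncomputable section

namespace Summit.Ventures.HodgeRepro.Tier4.Line3

open Matrix NumberField

/-- The Gaussian majorant `K₁ (1 + ‖x‖)^k e^{−a ‖x‖²}` on a normed space. -/
def gaussMaj {V : Type*} [NormedAddCommGroup V] (K₁ k a : ℝ) (x : V) : ℝ :=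
  K₁ * (1 + ‖x‖) ^ k * Real.exp (-(a * ‖x‖ ^ 2))

namespace T4Data

variable (X : T4Data)

/-- The archimedean embedding `v ↦ (σ (v i))_{σ, i}` of `E′³` into `(E′ →+* ℂ) → Fin 3 → ℂ`. -/
def embV (v : Fin 3 → X.E) : (X.E →+* ℂ) → Fin 3 → ℂ := fun σ i => σ (v i)

/-- `embV` as an additive homomorphism. -/
def embAdd : (Fin 3 → X.E) →+ ((X.E →+* ℂ) → Fin 3 → ℂ) where
  toFun := X.embV
  map_zero' := by
    funext σ i
    simp [embV]
  map_add' := fun v w => by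
    funext σ i
    simp [embV, map_add]

/-- `embAdd` is `embV`. -/
@[simp] theorem embAdd_apply (v : Fin 3 → X.E) : X.embAdd v = X.embV v := rfl

/-- `embV` is injective (already its `τ₀`-component is). -/
theorem embV_injective : Function.Injective X.embV := by
  intro v w h
  funext i
  have h1 : X.τ₀ (v i) = X.τ₀ (w i) := congrFun (congrFun h X.τ₀) i
  exact X.τ₀.injective h1

/-- The image of an `𝒪_{E′}`-submodule of `E′³` under `embV`, as a `ℤ`-submodule of `(E′ →+* ℂ) → Fin 3 → ℂ`. -/
def latt (L : Submodule (RingOfIntegers X.E) (Fin 3 → X.E)) : Submodule ℤ ((X.E →+* ℂ) → Fin 3 → ℂ) :=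
  Submodule.map X.embAdd.toIntLinearMap (L.restrictScalars ℤ)

/-- Membership in `latt L`. -/
theorem mem_latt {L : Submodule (RingOfIntegers X.E) (Fin 3 → X.E)} {x : (X.E →+* ℂ) → Fin 3 → ℂ} :
    x ∈ X.latt L ↔ ∃ v ∈ L, X.embV v = x := by
  unfold latt
  simp only [Submodule.mem_map, Submodule.restrictScalars_mem, AddMonoidHom.coe_toIntLinearMap, embAdd_apply]

/-- The lattice `L` is in bijection with its image `latt L`. -/
def lattEquiv (L : Submodule (RingOfIntegers X.E) (Fin 3 → X.E)) : L ≃ X.latt L :=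
  Equiv.ofBijective (fun v => ⟨X.embV v, X.mem_latt.mpr ⟨v, v.2, rfl⟩⟩) (by
    constructor
    · intro v w h
      apply Subtype.ext
      exact X.embV_injective (congrArg Subtype.val h)
    · intro x
      obtain ⟨v, hv, hvx⟩ := X.mem_latt.mp x.2
      exact ⟨⟨v, hv⟩, Subtype.ext hvx⟩)

/-- The bijection `L ≃ latt L` is `embV` on the underlying vectors. -/
@[simp] theorem lattEquiv_apply_coe (L : Submodule (RingOfIntegers X.E) (Fin 3 → X.E)) (v : L) :
    ((X.lattEquiv L v : X.latt L) : (X.E →+* ℂ) → Fin 3 → ℂ) = X.embV v := rfl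

/-- The per-vector factor of the majorant with the definite Gaussians. -/
def vecFactor (c₁ e : ℝ) (v : Fin 3 → X.E) (z : Fin 2 → ℂ) : ℝ :=
  (1 + ‖X.ballCoord v‖) ^ e * ((∑ i, ‖X.ballCoord v i‖) ^ 2 * Real.exp (-(Real.pi / 2) * maj (X.ballCoord v) z)) *
    X.gaussDefAt c₁ v

/-- The constant `Σ_{i,j} ‖C⁻¹_{ij}‖`. -/
def kCinv : ℝ := ∑ i, ∑ j, ‖X.C⁻¹ i j‖

/-- The constant `Σ_{i,j} ‖C_{ij}‖`. -/
def kC : ℝ := ∑ i, ∑ j, ‖X.C i j‖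

/-- The Gaussian exponent constant `c₃ = min c₁ (π / (24 kC²))`. -/
def cGauss (c₁ : ℝ) : ℝ := min c₁ (Real.pi / (24 * X.kC ^ 2))

/-- The polynomial constant `K₁`. -/
def kPoly (e : ℝ) : ℝ := (max 1 X.kCinv) ^ (max e 0) * (3 * X.kCinv) ^ 2

/-- The line tuples of the tuples with all four vectors in `L`. -/
def linesOf (L : Submodule (RingOfIntegers X.E) (Fin 3 → X.E)) : Set X.LineTuple :=
  {w | ∃ x : X.Tuple, X.lines x = w ∧ ∀ j, x j ∈ L}

/-- A chosen tuple of `L`-vectors representing a line tuple of `linesOf L`. -/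
def tupOf (L : Submodule (RingOfIntegers X.E) (Fin 3 → X.E)) (w : X.linesOf L) : Fin 4 → L :=
  fun j => ⟨Classical.choose w.2 j, (Classical.choose_spec w.2).2 j⟩

end T4Data

end Summit.Ventures.HodgeRepro.Tier4.Line3

end
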